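import Summits.ResolutionOfSingularities.ResolutionOfSingularities.Theorems.FrobeniusClosingPatchingRelPerfectDepthOneTargetsDefs
import Summits.ResolutionOfSingularities.ResolutionOfSingularities.Theorems.FrobeniusClosingPatchingRelPerfectDepthOneExceptionalDimension
import HarnessLib

/-!
# Crux `PatchingRelPerfect` (stmt-ResolutionOfSingularities-16161), chain w52 — programme r-d1,
# piece I1 BY NAME: `DepthOneTargets.ExceptionalPackage` holds

[OURS · L1 W5.2 · rung tool] CHAIN.md v1.5 §2 (row stub-3; volunteer hand res-D-pv-055, HOLDS TABLE
lead-2 2026-08-27).  Plan-1's typed target I1 (`…DepthOneTargetsDefs.lean`, p496180, decl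
`DepthOneTargets.ExceptionalPackage`): for `S` regular local with `dim S = 4`, `x` a family spanning
`𝔪` and `I ≠ 0` of exceptional depth one (`I ⊆ 𝔪ᵈ`, `x_i^{d+1} ∈ I`), there are `g : X ⟶ Spec S`,
`i : E ⟶ X`, `𝔟` with `DepthOneInvariant S I E X i g 𝔟` and `E` integral, Noetherian, excellent of
dimension `3`.  PROVED:

* `DepthOne.exceptionalPackage_model` — the invariant and the side conditions at the MODEL
  `X = Bl_𝔪 Spec S` (`affineBlowup`), `E = V(𝔪𝒪_X)`, `i = subschemeι`, `M = 𝓘_Eᵈ`, `K =` the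
  controlled transform `(I𝒪_X : 𝓘_Eᵈ)`, `𝔟 = K|_E`, for a regular system of parameters
  `y = (y₀, …, y_m)`, with `dim E = m`: res-L1-w52-stub-3's parts 1–2 (`DepthOne.depthOne_format`
  p493964, `…DepthOneExceptionalDivisor` p494999) and part 3 (`DepthOne.topologicalKrullDim_exceptional`,
  p496054);
* `DepthOneTargets.exceptionalPackage_holds : DepthOneTargets.ExceptionalPackage` — **I1 closed by
  name** (a regular local ring of dimension `4` has a regular system of parameters of length `4`).

Nothing here is a statement of the manuscript under review.

## References

* Q. Liu, *Algebraic Geometry and Arithmetic Curves* (2002), Thm. 8.1.19 (a), (b). [Liu2002]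
* J. Kollár, *Lectures on Resolution of Singularities* (2007), (3.111) Step 3. [Kollar2007]
* R. Hartshorne, *Algebraic Geometry* (1977), II Thm. 8.24 (b). [Hartshorne1977]
-/

-- `Summit.<Summit>.<Sub>.Theorems` with `Sub = Summit` (single-conjunct summit, D-0017)
set_option linter.dupNamespace false

noncomputable section

open CategoryTheory CategoryTheory.Limits AlgebraicGeometry Literature.AlgebraicGeometry.Resolution
open IsLocalRing TopologicalSpace

namespace Summit.ResolutionOfSingularities.ResolutionOfSingularities.Theorems

universe u

namespace DepthOne

section Package

variable {S : Type u} [CommRing S] [IsRegularLocalRing S] {m : ℕ} (y : Fin (m + 1) → S)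
  (hy : Ideal.span (Set.range y) = IsLocalRing.maximalIdeal S)
  (hd : (IsLocalRing.maximalIdeal S).spanFinrank = m + 1)
  {n : ℕ} (x : Fin n → S) (hx : Ideal.span (Set.range x) = IsLocalRing.maximalIdeal S)
  {I : Ideal S} {d : ℕ} (hId : I ≤ IsLocalRing.maximalIdeal S ^ d) (hxI : ∀ i, x i ^ (d + 1) ∈ I)

local notation3 "M" => Ideal.span (Set.range y)
local notation3 "X" => affineBlowup (Ideal.span (Set.range y))
local notation3 "g" => affineBlowup.π (Ideal.span (Set.range y))
local notation3 "𝓔" => (affineBlowup.idealSheaf (Ideal.span (Set.range y))).comap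
  (affineBlowup.π (Ideal.span (Set.range y)))
local notation3 "K" => controlledTransform (affineBlowup.π (Ideal.span (Set.range y)))
  (affineBlowup.idealSheaf (Ideal.span (Set.range y))) (affineBlowup.idealSheaf I) d

include hy in
/-- The centre `𝔪~` of `g : Bl_𝔪 Spec S → Spec S` is cosupported in the closed point. [folklore] -/
theorem support_idealSheaf_span_subset :
    ((affineBlowup.idealSheaf (M)).support : Set (Spec (.of S))) ⊆ {IsLocalRing.closedPoint S} :=
  fun s hs => support_idealSheaf_subset_closedPoint (Q := M) (n := 1) (by rw [hy, pow_one]) s hs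

include hy hd hx hId hxI in
/-- **The exceptional package at the model** `X = Bl_𝔪 Spec S ⊃ E = V(𝔪𝒪_X)`, `i = subschemeι`,
`𝔟 = K|_E` with `K = (I𝒪_X : 𝓘_Eᵈ)` and `M = 𝓘_Eᵈ`: plan-1's `DepthOneInvariant S I E X i g 𝔟` holds
(`X` Noetherian and regular, `E` regular, `i` a closed immersion with effective Cartier ideal, `E`
over the closed point, `g` a blow-up cosupported in the closed point, FORMAT `I𝒪_X = 𝓘_Eᵈ · K` with
`𝓘_E ≤ K`), and `E` is integral, Noetherian, excellent, of dimension `m` (`y` a regular system of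
parameters of length `m + 1`). [cite: Liu2002, Thm. 8.1.19 (a), (b)] [cite: Kollar2007, (3.111) Step 3] -/
theorem exceptionalPackage_model :
    DepthOneTargets.DepthOneInvariant S I (𝓔).subscheme (X) (𝓔).subschemeι (g)
        ((K).comap (𝓔).subschemeι) ∧
      IsIntegral (𝓔).subscheme ∧ IsNoetherian (𝓔).subscheme ∧ Scheme.IsExcellent (𝓔).subscheme ∧
      topologicalKrullDim (𝓔).subscheme = m := by
  have h𝔪 : Ideal.span (Set.range x) = M := hx.trans hy.symm
  have hId' : I ≤ (M) ^ d := by rwa [hy]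
  obtain ⟨hEd, hle, hfmt⟩ := depthOne_format x h𝔪 (affineBlowup.isBlowup (M)) hId' hxI
  refine ⟨⟨isNoetherian_blowup y, isRegular_blowup y hy, isRegular_exceptional y hy hd, inferInstance,
    ker_subschemeι_isEffectiveCartier y, map_exceptional_eq_closedPoint y hy,
    ⟨_, affineBlowup.isBlowup (M), support_idealSheaf_span_subset y hy⟩,
    ⟨_, K, hEd, ?_, rfl, hfmt⟩⟩, isIntegral_exceptional y hy hd, isNoetherian_exceptional y,
    isExcellent_exceptional y hy, topologicalKrullDim_exceptional y hy hd⟩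
  rwa [Scheme.IdealSheafData.ker_subschemeι]

end Package

/-- A regular local ring of Krull dimension `4` has a regular system of parameters of length
`3 + 1`. [folklore] -/
theorem exists_rsop_four {S : Type u} [CommRing S] [IsRegularLocalRing S]
    (hdim : ringKrullDim S = (4 : ℕ)) :
    (IsLocalRing.maximalIdeal S).spanFinrank = 3 + 1 ∧
      ∃ y : Fin (3 + 1) → S, Ideal.span (Set.range y) = IsLocalRing.maximalIdeal S := by
  have hd : (IsLocalRing.maximalIdeal S).spanFinrank = 3 + 1 := by
    have h := IsRegularLocalRing.spanFinrank_maximalIdeal (R := S)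
    rw [hdim] at h
    exact_mod_cast h
  obtain ⟨y₀, hy₀⟩ := exists_regularSystemOfParameters (R := S)
  refine ⟨hd, y₀ ∘ finCongr hd.symm, ?_⟩
  rw [(finCongr hd.symm).surjective.range_comp y₀, hy₀]

end DepthOne

namespace DepthOneTargets

/-- **I1 by name**: plan-1's typed target `DepthOneTargets.ExceptionalPackage` holds — at the model
`Bl_𝔪 Spec S ⊃ V(𝔪𝒪)` built on a regular system of parameters (`DepthOne.exceptionalPackage_model`);
`I ≠ 0` is part of the binder shape and unused. [cite: Liu2002, Thm. 8.1.19 (a), (b)]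
[cite: Kollar2007, (3.111) Step 3] [cite: Hartshorne1977, II Thm. 8.24 (b)] -/
theorem exceptionalPackage_holds : ExceptionalPackage.{u} := by
  intro S _ _ hdim n x hx I _ hdepth
  obtain ⟨hd, y, hy⟩ := DepthOne.exists_rsop_four hdim
  obtain ⟨d, hId, hxI⟩ := hdepth
  obtain ⟨hinv, hint, hnoeth, hexc, hdimE⟩ := DepthOne.exceptionalPackage_model y hy hd x hx hId hxI
  refine ⟨_, _, _, _, _, hinv, hint, hnoeth, hexc, ?_⟩
  rw [hdimE]
  rfl

end DepthOneTargets

end Summit.ResolutionOfSingularities.ResolutionOfSingularities.Theorems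

end
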